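import Summits.QuantumFields.YangMills.Theorems.BalabanUVNodesN18AvgRemainderLipschitz

/-!
# BalabanUVNodes ∕ node N18 = NE5 — closure-ledger item (iii), (β3) first brick: COARSE DIFFERENCES OF THE SECOND-ORDER REMAINDER OF THE (0.4) AVERAGE — the
# remainder `R_c(U) = Ū(c) − 1 − (Q₁Y)(c)` is translation-covariant (`R_{c+a}(U) = R_c(U ∘ τ_{La})`, `BlockAveraging.avgFun_translate` + the linear term's
# covariance proved here), so module 25 gives `‖R_{c+a}(U) − R_c(U)‖ ≤ 181·ℓ²·δ·sup_b‖U_{b+La} − U_b‖`: the coarse difference quotient of the remainder is SECOND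
# ORDER (`δ ×` the field's own difference), which is what the `|∇Ā|`-letter of (1.12) for a transported field needs beyond King's K-row (module 19a)
# (Track A, DAG node N18 = `T4OutputRate.NE5` :211; cluster K4 «SpineRates», item K3⁷ `SpineGivenEndpointR13SepCoPH`; module 26 of seat pub-ymgap-dag-n18-d, strategy s2)

HONEST FRAMING.  Count-neutral kernel bookkeeping (`--supports stmt-QuantumFields-20544 --as helper`); elementary, PROVED (translation covariance of walks,
signed sums and the linear block average `linAvg`; then module 25).  NE5 is NOT PRINTED and NOT proved; N18 is NOT discharged; the chart step `A ↦ exp(iξA)`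
and the (1.12) letters themselves ((β3) proper of the seat's `N18-BETA-SPEC.md`) are the successor's.

WHAT.  `walkEnd_add` (`walkEnd (x + a) w = walkEnd x w + a`), `walkSum_translate` (signed sums of a translated bond field = signed sums along translated steps),
★ `linAvg_translate` (`Q₁(Y ∘ τ_{La})(c) = (Q₁Y)(c + a)`), `norm_translate_nsmul_sub_le` (telescoping),
`avgFun_translate_apply`,
★ `avgRem_translate` (`R_c(U ∘ τ_{La}) = R_{c+a}(U)`), ★ `norm_avgRem_translate_sub_le` (the statement in the title).

WHAT THIS IS NOT.  Not the (1.12) letters; not (β); finite tori — not continuum ∕ OS ∕ mass gap ∕ Clay.  0 `def`, 0 `sorry`, standard axioms.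
-/

open scoped BigOperators

namespace YMDAG.N18.HolonomyLipschitz

open Literature.MathematicalPhysics.QuantumFieldTheory.Balaban1983to89
open Literature.MathematicalPhysics.QuantumFieldTheory.Balaban1983to89.T4Continuum
open Literature.MathematicalPhysics.QuantumFieldTheory.Balaban1983to89.BlockAveraging
open Literature.MathematicalPhysics.QuantumFieldTheory.Balaban1983to89.ExpMeanLog (deltaSU expMeanLogSU)
open Literature.MathematicalPhysics.QuantumFieldTheory.Balaban1983to89.BlockAveragingEMLLinearised (walkSum linAvg linAvg_def)

/-! ## §1 Translation covariance of walk ends, signed sums and the linear block average -/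

section Covariance

variable {P : Params} {j : ℕ}

/-- The end of a walk from a translated base is the translated end. [folklore] -/
theorem walkEnd_add (x a : Site P j) : ∀ (w : List (Letter P.d)), walkEnd (x + a) w = walkEnd x w + a := by
  intro w
  induction w generalizing x with
  | nil => rfl
  | cons l w ih =>
    obtain ⟨μ, b⟩ := l
    cases b
    · simp only [walkEnd, Site.unshift_add, ih]
    · simp only [walkEnd, Site.shift_add, ih]

/-- The target of a translated bond is the translated target (public twin `PBond.translate_tgt` in `BlockAveragingTwoLevel`, not imported here; kept private). [folklore] -/
private theorem tgt_translate (a : Site P j) (b : PBond P j) : (b.translate a).tgt = b.tgt + a := by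
  simp only [PBond.tgt, PBond.translate_src, PBond.translate_dir, Site.shift_add]

variable {V : Type*} [AddCommGroup V]

/-- **Signed sums of a translated bond field are signed sums along the translated steps**: `Σ_{s∈Γ} ±Y(b(s) + a) = Σ_{s ∈ Γ + a} ±Y(b(s))`.
[cite: Balaban1984PropagatorsI, (1.8) p.19 (bookkeeping)] -/
theorem walkSum_translate (a : Site P j) (Y : PBond P j → V) (γ : List (LStep P j)) :
    walkSum (fun b => Y (b.translate a)) γ = walkSum Y (γ.map (LStep.translate a)) := by
  simp only [walkSum, List.map_map]
  rfl

variable {n : Type*}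

/-- ★ **THE LINEAR BLOCK AVERAGE IS TRANSLATION-COVARIANT**: `Q₁(Y ∘ τ_{La})(c) = (Q₁Y)(c + a)` — the contours of (124)–(125) from `c + a` are the translates by
`La` of those from `c` (`walk_translate`, `walkEnd_add`, `Site.emb_add`). [cite: Balaban1985Averaging, (124)-(125) p.36; Balaban1987RG1, (2.17) p.269] -/
theorem linAvg_translate (a : Site P (j + 1)) (Y : PBond P j → Matrix n n ℂ) (c : PBond P (j + 1)) :
    linAvg (fun b => Y (b.translate (Site.scale a))) c = linAvg Y (c.translate a) := by
  rw [linAvg_def, linAvg_def]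
  congr 1
  refine Finset.sum_congr rfl fun i _ => ?_
  rw [walkSum_translate, walkSum_translate, walkSum_translate, ← walk_translate, ← walk_translate, ← walk_translate, ← walkEnd_add]
  simp only [PBond.translate_src, PBond.translate_dir, tgt_translate, Site.emb_add]

end Covariance

/-! ## §2 Coarse differences of the remainder -/

section CoarseDiff

open scoped Matrix.Norms.L2Operator

variable {n : Type*} [Fintype n] [DecidableEq n] [Nonempty n] {P : Params} {j : ℕ}

omit [Nonempty n] in
/-- **Telescoping translations**: if `U` moves by at most `η` under the translation by `e`, it moves by at most `m·η` under the translation by `m·e`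
(`PBond.translate_translate`); with `e = e_ν` at level `j` and `m = L` this converts the hypothesis of `norm_avgRem_translate_sub_le` (translation by
`La = scale a`) into unit differences of the fine field. [folklore] -/
theorem norm_translate_nsmul_sub_le (U : GaugeField P j (Matrix.specialUnitaryGroup n ℂ)) (e : Site P j) {η : ℝ} (hη : 0 ≤ η)
    (h : ∀ b, ‖((U (b.translate e) : Matrix.specialUnitaryGroup n ℂ) : Matrix n n ℂ) - ((U b : Matrix.specialUnitaryGroup n ℂ) : Matrix n n ℂ)‖ ≤ η) :
    ∀ (m : ℕ) (b : PBond P j),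
      ‖((U (b.translate (m • e)) : Matrix.specialUnitaryGroup n ℂ) : Matrix n n ℂ) - ((U b : Matrix.specialUnitaryGroup n ℂ) : Matrix n n ℂ)‖ ≤ m * η
  | 0, b => by
    have h0 : b.translate ((0 : ℕ) • e) = b := by cases b; simp [PBond.translate]
    rw [h0, sub_self, norm_zero, Nat.cast_zero, zero_mul]
  | m + 1, b => by
    have ih := norm_translate_nsmul_sub_le U e hη h m b
    have hs : b.translate ((m + 1) • e) = (b.translate (m • e)).translate e := by rw [PBond.translate_translate, succ_nsmul]
    rw [hs]
    calc _ ≤ ‖((U ((b.translate (m • e)).translate e) : Matrix.specialUnitaryGroup n ℂ) : Matrix n n ℂ) -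
              ((U (b.translate (m • e)) : Matrix.specialUnitaryGroup n ℂ) : Matrix n n ℂ)‖ +
            ‖((U (b.translate (m • e)) : Matrix.specialUnitaryGroup n ℂ) : Matrix n n ℂ) - ((U b : Matrix.specialUnitaryGroup n ℂ) : Matrix n n ℂ)‖ :=
          norm_sub_le_norm_sub_add_norm_sub _ _ _
      _ ≤ η + m * η := add_le_add (h _) ih
      _ = ((m + 1 : ℕ) : ℝ) * η := by push_cast; ring

/-- `Ū∘τ` pointwise: `avgFun ℰ (U ∘ τ_{La}) c = (avgFun ℰ U)(c + a)` (`BlockAveraging.avgFun_translate` evaluated). [cite: Balaban1987RG1, (2.17) p.269] -/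
theorem avgFun_translate_apply (a : Site P (j + 1)) (U : GaugeField P j (Matrix.specialUnitaryGroup n ℂ)) (c : PBond P (j + 1)) :
    avgFun (expMeanLogSU (n := n)) (U.translate (Site.scale a)) c = avgFun (expMeanLogSU (n := n)) U (c.translate a) := by
  rw [avgFun_translate, GaugeField.translate_apply]

/-- ★ **THE REMAINDER IS TRANSLATION-COVARIANT**: `R_c(U ∘ τ_{La}) = R_{c+a}(U)` for `R_c(U) = Ū(c) − 1 − (Q₁(U − 1))(c)`.
[cite: Balaban1985Averaging, Prop. 3 (122)-(125) p.36; Balaban1987RG1, (2.17) p.269] -/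
theorem avgRem_translate (a : Site P (j + 1)) (U : GaugeField P j (Matrix.specialUnitaryGroup n ℂ)) (c : PBond P (j + 1)) :
    ((avgFun (expMeanLogSU (n := n)) (U.translate (Site.scale a)) c : Matrix.specialUnitaryGroup n ℂ) : Matrix n n ℂ) - 1 -
        linAvg (fun b => (((U.translate (Site.scale a)) b : Matrix.specialUnitaryGroup n ℂ) : Matrix n n ℂ) - 1) c =
      ((avgFun (expMeanLogSU (n := n)) U (c.translate a) : Matrix.specialUnitaryGroup n ℂ) : Matrix n n ℂ) - 1 -
        linAvg (fun b => ((U b : Matrix.specialUnitaryGroup n ℂ) : Matrix n n ℂ) - 1) (c.translate a) := by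
  rw [avgFun_translate_apply]
  simp only [GaugeField.translate_apply]
  rw [linAvg_translate a (fun b => ((U b : Matrix.specialUnitaryGroup n ℂ) : Matrix n n ℂ) - 1) c]

/-- ★ **COARSE DIFFERENCES OF THE SECOND-ORDER REMAINDER ARE SECOND ORDER.**  If every bond variable of `U` is within `δ` of `1`, `24ℓδ ≤ 1`, `ℓδ < δ_N`
(`ℓ = (d+2)L`), and `U` differs from its translate by `La` by at most `η` bondwise (`‖U(b + La) − U(b)‖ ≤ η`), then for every coarse bond `c`
`‖R_{c+a}(U) − R_c(U)‖ ≤ 181·ℓ²·δ·η` — module 25 at the pair `(U ∘ τ_{La}, U)` and `avgRem_translate`.  With `a = e_ν` and `η ≤ L·sup‖U(b + e) − U(b)‖` this is the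
second-order smallness of the coarse gradient of the remainder that the `|∇Ā|`-letter of (1.12) needs beyond King's K-row.
[cite: Balaban1985Averaging, Prop. 3 (122)-(125) p.36; Balaban1987RG1, (1.12) p.261 and (2.17) p.269] -/
theorem norm_avgRem_translate_sub_le (U : GaugeField P j (Matrix.specialUnitaryGroup n ℂ)) (a : Site P (j + 1)) {δ η : ℝ} (hδ : 0 ≤ δ) (hη : 0 ≤ η)
    (hU : ∀ b, ‖((U b : Matrix.specialUnitaryGroup n ℂ) : Matrix n n ℂ) - 1‖ ≤ δ)
    (hUa : ∀ b, ‖((U (b.translate (Site.scale a)) : Matrix.specialUnitaryGroup n ℂ) : Matrix n n ℂ) - ((U b : Matrix.specialUnitaryGroup n ℂ) : Matrix n n ℂ)‖ ≤ η)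
    (h24 : 24 * ((((P.d + 2) * P.L : ℕ) : ℝ) * δ) ≤ 1) (hN : (((P.d + 2) * P.L : ℕ) : ℝ) * δ < deltaSU n) (c : PBond P (j + 1)) :
    ‖(((avgFun (expMeanLogSU (n := n)) U (c.translate a) : Matrix.specialUnitaryGroup n ℂ) : Matrix n n ℂ) - 1 -
          linAvg (fun b => ((U b : Matrix.specialUnitaryGroup n ℂ) : Matrix n n ℂ) - 1) (c.translate a)) -
        (((avgFun (expMeanLogSU (n := n)) U c : Matrix.specialUnitaryGroup n ℂ) : Matrix n n ℂ) - 1 -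
          linAvg (fun b => ((U b : Matrix.specialUnitaryGroup n ℂ) : Matrix n n ℂ) - 1) c)‖ ≤
      181 * ((((P.d + 2) * P.L : ℕ) : ℝ)) ^ 2 * δ * η := by
  rw [← avgRem_translate a U c]
  exact norm_avgRem_sub_avgRem_le (U.translate (Site.scale a)) U hδ hη (fun b => by rw [GaugeField.translate_apply]; exact hU _) hU
    (fun b => by rw [GaugeField.translate_apply]; exact hUa b) h24 hN c

end CoarseDiff

end YMDAG.N18.HolonomyLipschitz
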